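import Literature.NumberTheory.GaloisCohomology.Howard2004.DVRSettingDualSelmerTransferProofs
import Literature.NumberTheory.GaloisCohomology.Howard2004.TowerSelmerTransposeDualSelmerProofs
import Literature.NumberTheory.GaloisCohomology.Howard2004.DVRSettingEngineData
import HarnessLib

/-!
# Howard 2004, Prop. 1.4.1 / Thm. 1.4.2 proof — the transfer `Ψ : H¹(K, T) → H¹(K, T^∨(1))` is `R`-SEMILINEAR for the
# transposed scalars: `Ψ (r • c) = H¹(r^D) (Ψ c)`; the dual slot on Howard's module `𝓗_j(n) = H¹_{𝓕(n)}(K, T^{(j)})` (theorems only)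

Topic `NumberTheory/GaloisCohomology/Howard2004`. THEOREMS ONLY: no definition, no named fact, no instance, no notation,
no `sorry`.  Cell `pub/bsd-print-x9` (seat x10b-p1-w7 g12, brick «C451-CL Q4, slice 4 = SCALARS» of LEAD g14's class-level plan
(14:13:21Z: «an additive bijection `Ψ : ↥𝓗_0(n) → ↥Sel_{𝓕(n)_0^*}(K, N_0^D)` with `Ψ (r • w) = r^D • Ψ w`»); `--supports
stmt-BirchSwinnertonDyer-22642`).  Sequel of `ConjugationTwistTransferProofs` (slice 1: the transfer `Ψ [φ] = [g ↦ Θ(φ(g^τ))]`),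
`DualityDatumSelmerTransferProofs` (slice 2), `DVRSettingDualSelmerTransferProofs` (slice 3: the slot at every level `j`) and of
`TowerSelmerTransposeDualSelmerProofs` (x10b-p1-w8 g12: the transpose `r^D = pairingDualHom n₀ ((tateDualEval K T n₀).comp (r•))`
of the scalar endomorphism `r•`, and `H¹(r^D)` on dual Selmer groups).

* §1 GENERIC.  **`conjTransfer_scalarMapH1`** — for a conjugation datum, `ρ` `R`-linear, an additive `Θ : M → M′` intertwining
  `ρ ∘ conj` with `ρ′`, an equivariant additive `a′ : M′ → M′` with `Θ (r • m) = a′ (Θ m)`, and any transfer `Ψ` with the cocycle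
  formula of slice 1: `Ψ (H¹(r•) c) = H¹(a′) (Ψ c)` (both classes are `[g ↦ Θ(r • φ(g^τ))] = [g ↦ a′(Θ(φ(g^τ)))]`).
* §2 DUALITY DATA.  `e_smul_comm` (`e(s, r t) = e(r s, t)`), **`toTateDual_apply_eq_pairingDualHom`**: for an additive `a : M → M`
  SELF-ADJOINT for `e` (`e(s, a t) = e(a s, t)`), `Θ (a t) = a^D (Θ t)` with `a^D = pairingDualHom (p^k) ((tateDualEval K M (p^k)).comp a)`
  (`Θ t s = exp (λ (e s t))`); hence `conjTransfer_scalarMapH1_toTateDual`: `Ψ (H¹(r•) c) = H¹(r^D) (Ψ c)` for `Θ = D.toTateDual λ exp`.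
* §3 ON A `DVRSetting`, LEVEL `j` (scalars `r ∈ R` acting through `R ↠ R_j`): `e_level_smul_comm`,
  **`conjTransfer_scalarMapH1_level`**: `Ψ (H¹(r•) c) = H¹(r^D) (Ψ c)` with `r^D` VERBATIM the transpose of
  `TowerSelmerTransposeDualSelmerProofs.scalarTranspose_mem_dualSelmerGroup_atLevel`; and the slot on Howard's `R`-module
  **`exists_addEquiv_selmerModuleAt_dualSelmerGroup`**: `∃ e : ↥(S.selmerModuleAt hy j n) ≃+ ↥H¹_{𝓕(n)_j^*}(K, T^{(j)∨}(1))`,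
  `↑(e c) = Ψ c` and `↑(e (r • c)) = H¹(r^D) ↑(e c)` — LEAD g14's Q4 as worded, at every level `j` (Q7 uses `j = 0`).
* §4 RESIDUAL TWIN: `conjTransfer_scalarMapH1_residual` (`T̄`, scalars `R_k`, any residual datum `D̄`).
* §5 (ISO) LETTER: **`localTatePairingZMod_map_transportH1_eq_zero_of_mem_atLevel`** — `⟨ℓ, T^j_w ℓ′⟩_w = 0` for
  `ℓ ∈ 𝓕(n)_{j,w}`, `ℓ′ ∈ 𝓕(n)_{j,σw}`, VERBATIM the binder `hISO` of LEAD g14's `TowerCasselsTatePairingSkewSumProofs` at `j = t+1`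
  (any `ℤ_p`-semilinear `λ_j`; from slice 3's `⊆`-half and slice 2's bridge); `conjTransfer_mem_dualSelmerGroup_atLevel`
  (`Ψ_j` maps `H¹_{𝓕(n)_j}` into `H¹_{𝓕(n)_j^*}`, membership only, any semilinear `λ_j`); `conjTransfer_localization_level`
  (`loc_w (Ψ_j c) = T^j_w (loc_{σw} c)` in the BRIDGE spelling — the binders `hWa`/`hWb`/`hWb'` of the skew-sum identity).

HONEST FRAMING: no pairing is constructed; Prop. 1.4.1 / C45.1″ / Thm. 1.6.1 are NOT proved; no summit statement is proved;
the Birch–Swinnerton-Dyer conjecture is not proved by any of this.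
-/

set_option autoImplicit false

noncomputable section

open Function NumberField IsDedekindDomain Field CategoryTheory
open scoped NumberField ContRepresentation

namespace Literature.NumberTheory.GaloisCohomology.Howard2004

open Literature.NumberTheory.GaloisRepresentations
open Literature.NumberTheory.GaloisRepresentations.DiscreteGaloisModule
open Literature.NumberTheory.GaloisRepresentations.galoisCohomology (scalarMapH1 scalarMapH1_oneCocycleClass scalarCocycle
  scalarCocycle_apply)
open Literature.NumberTheory.GaloisCohomology (LocalInvariants)

/-! ## §1 The transfer commutes with scalars up to the intertwined endomorphism -/

section Generic

variable {K : Type} [Field K] [NumberField K]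
  {M : Type} [AddCommGroup M] [TopologicalSpace M] [DiscreteTopology M]
  {M' : Type} [AddCommGroup M'] [TopologicalSpace M'] [DiscreteTopology M']
  {R : Type} [CommRing R] [Module R M]

/-- **`Ψ (H¹(r•) c) = H¹(a′) (Ψ c)`** for the transfer `Ψ [φ] = [g ↦ Θ(φ(g^τ))]` along an additive `Θ : M → M′` (intertwining
`ρ ∘ conj` with `ρ′`) and an equivariant additive `a′ : M′ → M′` with `Θ (r • m) = a′ (Θ m)`: on cocycles both sides are
`g ↦ Θ(r • φ(g^τ)) = a′(Θ(φ(g^τ)))`.  (Howard, Prop. 1.4.1: the Cassels–Tate pairing is one of `R`-modules; Thm. 1.4.2 proof: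
the identification `H¹_{𝓕*}(K, T*) ≅ H¹_𝓕(K, T)` along `T* ≅ Tw(T)`.)
[cite: Howard2004HeegnerKolyvagin, Prop. 1.4.1 and Thm. 1.4.2 proof (arXiv:1202.6340 p0008 L83–98, L120–124)] [cite: SerreGaloisCohomology1997, Ch. I §2.4 (compatible pairs) and §5.8] -/
theorem conjTransfer_scalarMapH1 (cd : ConjugationDatum K) (ρ : DiscreteGaloisModule K M) (hρ : ρ.IsScalarLinear R)
    (ρ' : DiscreteGaloisModule K M') (Θ : M →+ M')
    (hΘ : ∀ (g : absoluteGaloisGroup K) (m : M), Θ (ρ (cd.conj g) m) = ρ' g (Θ m))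
    (a' : M' →+ M') (ha' : ∀ (g : absoluteGaloisGroup K) (x : M'), a' (ρ' g x) = ρ' g (a' x))
    (r : R) (hcomm : ∀ m : M, Θ (r • m) = a' (Θ m))
    (Ψ : galoisCohomology ρ 1 →+ galoisCohomology ρ' 1)
    (hΨ : ∀ (φ : contOneCocycles ρ.toTopRep) (ψ : contOneCocycles ρ'.toTopRep),
      (∀ g, ψ.1 g = Θ (φ.1 (cd.conj g))) → Ψ (oneCocycleClass _ φ) = oneCocycleClass _ ψ)
    (c : galoisCohomology ρ 1) :
    Ψ (scalarMapH1 ρ hρ r c) = ContinuousRep.cohomologyMap ρ' ρ' a' continuous_of_discreteTopology ha' 1 (Ψ c) := by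
  obtain ⟨φ, rfl⟩ := oneCocycleClass_surjective ρ.toTopRep c
  obtain ⟨ψ, hψ⟩ := exists_conjTwist_cocycle cd ρ ρ' Θ hΘ φ
  rw [hΨ φ ψ hψ, scalarMapH1_oneCocycleClass, cohomologyMap_one_oneCocycleClass]
  obtain ⟨χ, hχ⟩ := exists_conjTwist_cocycle cd ρ ρ' Θ hΘ (scalarCocycle ρ hρ r φ)
  rw [hΨ _ χ hχ]
  congr 1
  refine Subtype.ext (ContinuousMap.ext fun g => ?_)
  rw [hχ, scalarCocycle_apply, hcomm]
  change a' (Θ (φ.1 (cd.conj g))) = a' (ψ.1 g)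
  rw [hψ]

end Generic

/-! ## §2 Duality data: `Θ (a t) = a^D (Θ t)` for `a` self-adjoint, and the scalar case -/

namespace DualityDatum

variable {K : Type} [Field K] [NumberField K] {M : Type} [AddCommGroup M] [TopologicalSpace M]
  [DiscreteTopology M] [Finite M] {R : Type} [CommRing R] [Module R M] [TopologicalSpace R] [DiscreteTopology R]
  {p : ℕ} [Fact p.Prime] [Algebra ℤ_[p] R] {cd : ConjugationDatum K} {ρ : DiscreteGaloisModule K M}
  (D : DualityDatum p cd ρ R) {k : ℕ}
  (lam : R →+ ZMod (p ^ k))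
  (hlam : ∀ (z : ℤ_[p]) (r : R), lam (algebraMap ℤ_[p] R z * r) = PadicInt.toZModPow k z * lam r)
  (exp : ZMod (p ^ k) →+ MuCarrier K (p ^ k))
  (hexp : ∀ (g : absoluteGaloisGroup K) (x : ZMod (p ^ k)),
    exp (cyclotomicCharacterModPow K p k g * x) = mu K (p ^ k) g (exp x))

omit [Finite M] in
/-- `e(s, r • t) = e(r • s, t)` (`e` is `R`-bilinear). [cite: Howard2004HeegnerKolyvagin, §1.3 H.4 (arXiv:1202.6340 p. 7 L69–76)] -/
theorem e_smul_comm (r : R) (s t : M) : D.e s (r • t) = D.e (r • s) t := by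
  rw [LinearMap.map_smul, LinearMap.map_smul, LinearMap.smul_apply]

/-- **`Θ (a t) = a^D (Θ t)`** for an additive `a : M → M` self-adjoint for `e` (`e(s, a t) = e(a s, t)`), where
`a^D = pairingDualHom (p^k) ((tateDualEval K M (p^k)).comp a)` is the transpose `f ↦ f ∘ a` of `a` on `M^∨(1) = Hom(M, μ_{p^k})`:
both sides send `s` to `exp (λ (e(a s, t)))`. [cite: Howard2004HeegnerKolyvagin, §1.3 H.4 and Prop. 1.4.1 (arXiv:1202.6340 p. 7 L69–80, p0008 L83–98)] [cite: MilneADT2006, Ch. I §2 (`M^D`)] -/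
theorem toTateDual_apply_eq_pairingDualHom (a : M →+ M) (hadj : ∀ s t : M, D.e s (a t) = D.e (a s) t) (t : M) :
    (D.toTateDual lam hlam exp hexp).toContinuousLinearMap.toLinearMap.toAddMonoidHom (a t) =
      pairingDualHom (p ^ k) ((tateDualEval K M (p ^ k)).comp a)
        ((D.toTateDual lam hlam exp hexp).toContinuousLinearMap.toLinearMap.toAddMonoidHom t) := by
  refine TateDual.ext fun s => ?_
  change exp (lam (D.e s (a t))) = exp (lam (D.e (a s) t))
  rw [hadj]

/-- **`Ψ (H¹(r•) c) = H¹(r^D) (Ψ c)` for the transfer along `Θ = D.toTateDual λ exp`** (`r ∈ R`, the datum's ring; `r^D` the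
transpose of `r•`). [cite: Howard2004HeegnerKolyvagin, Prop. 1.4.1 and Thm. 1.4.2 proof (arXiv:1202.6340 p0008 L83–98, L120–124)] [cite: MilneADT2006, Ch. I §2] -/
theorem conjTransfer_scalarMapH1_toTateDual (hρ : ρ.IsScalarLinear R) (r : R)
    (Ψ : galoisCohomology ρ 1 →+ galoisCohomology (ρ.tateDual (p ^ k)) 1)
    (hΨ : ∀ (φ : contOneCocycles ρ.toTopRep) (ψ : contOneCocycles (ρ.tateDual (p ^ k)).toTopRep),
      (∀ g, ψ.1 g = (D.toTateDual lam hlam exp hexp).toContinuousLinearMap.toLinearMap.toAddMonoidHom (φ.1 (cd.conj g))) →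
        Ψ (oneCocycleClass _ φ) = oneCocycleClass _ ψ)
    (c : galoisCohomology ρ 1) :
    Ψ (scalarMapH1 ρ hρ r c) =
      ContinuousRep.cohomologyMap (ρ.tateDual (p ^ k)) (ρ.tateDual (p ^ k))
        (pairingDualHom (p ^ k) ((tateDualEval K M (p ^ k)).comp (DistribSMul.toAddMonoidHom M r)))
        continuous_of_discreteTopology
        (pairingDualHom_smul (pairing_comp_smul ρ ρ (p ^ k) (DistribSMul.toAddMonoidHom M r)
          (fun g y => (hρ g r y).symm))) 1 (Ψ c) :=
  conjTransfer_scalarMapH1 cd ρ hρ (ρ.tateDual (p ^ k)) _ (D.toTateDual_semilinear lam hlam exp hexp) _ _ r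
    (fun m => D.toTateDual_apply_eq_pairingDualHom lam hlam exp hexp (DistribSMul.toAddMonoidHom M r)
      (fun s t => D.e_smul_comm r s t) m) Ψ hΨ c

end DualityDatum

/-! ## §3 On a `DVRSetting`: the level `j`, scalars `r ∈ R` -/

namespace DVRSetting

variable {p : ℕ} [Fact p.Prime] {K : Type} [Field K] [NumberField K]
  {R : Type} [CommRing R] [IsDomain R] [IsDiscreteValuationRing R] [Algebra ℤ_[p] R]
  {N : ℕ → Type} [∀ k, AddCommGroup (N k)] [∀ k, TopologicalSpace (N k)]
  [∀ k, DiscreteTopology (N k)] [∀ k, Module R (N k)]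
  {Rk : ℕ → Type} [∀ k, CommRing (Rk k)] [∀ k, IsLocalRing (Rk k)] [∀ k, TopologicalSpace (Rk k)]
  [∀ k, DiscreteTopology (Rk k)] [∀ k, Algebra ℤ_[p] (Rk k)] [∀ k, Algebra R (Rk k)]
  [∀ k, Module (Rk k) (N k)] [∀ k, IsScalarTower R (Rk k) (N k)]
  {Nbar : Type} [AddCommGroup Nbar] [TopologicalSpace Nbar] [DiscreteTopology Nbar]
  [∀ k, Module (Rk k) Nbar]
  {Nq : ℕ → Finset (HeightOneSpectrum (𝓞 K)) → Type} [∀ k n, AddCommGroup (Nq k n)]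
  [∀ k n, TopologicalSpace (Nq k n)] [∀ k n, DiscreteTopology (Nq k n)]
  [∀ k n, Module (Rk k) (Nq k n)] [∀ k n, Module R (Nq k n)]
  [∀ k n, IsScalarTower R (Rk k) (Nq k n)]

/-- `e_j(s, r • t) = e_j(r • s, t)` for the DVR scalars `r ∈ R` acting on `T^{(j)}` through `R → R_j` (`e_j` is `R_j`-bilinear).
[cite: Howard2004HeegnerKolyvagin, §1.3 H.4 and §1.6 (arXiv:1202.6340 p. 7 L69–76, p. 11 L13–17)] -/
theorem e_level_smul_comm (S : DVRSetting p K R N Rk Nbar Nq) (j : ℕ) (r : R) (s t : N j) :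
    (S.D j).e s (r • t) = (S.D j).e (r • s) t := by
  rw [← algebraMap_smul (Rk j) r t, ← algebraMap_smul (Rk j) r s]
  exact (S.D j).e_smul_comm (algebraMap R (Rk j) r) s t

/-- **`Ψ (H¹(r•) c) = H¹(r^D) (Ψ c)` at the level `j`** for the transfer `Ψ` along `Θ_j = (S.D j).toTateDual λ exp` and the
DVR scalars `r ∈ R` (`H¹(r•) = scalarMapH1 (S.T.ρ j) (S.T.hlin j) r`; `r^D` VERBATIM the transpose of
`TowerSelmerTransposeDualSelmerProofs`): the transfer is `R`-semilinear for the transposed action on `H¹(K, T^{(j)∨}(1))`.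
[cite: Howard2004HeegnerKolyvagin, Prop. 1.4.1 and Thm. 1.4.2 proof (arXiv:1202.6340 p0008 L83–98, L120–124)] [cite: MilneADT2006, Ch. I §2 and Cor. 2.3] -/
theorem conjTransfer_scalarMapH1_level [∀ k, Finite (N k)] (S : DVRSetting p K R N Rk Nbar Nq) (j : ℕ) {k' : ℕ}
    (exp : ZMod (p ^ k') →+ MuCarrier K (p ^ k'))
    (hexp : ∀ (g : absoluteGaloisGroup K) (x : ZMod (p ^ k')),
      exp (cyclotomicCharacterModPow K p k' g * x) = mu K (p ^ k') g (exp x))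
    (lam : Rk j →+ ZMod (p ^ k'))
    (hlam : ∀ (z : ℤ_[p]) (a : Rk j), lam (algebraMap ℤ_[p] (Rk j) z * a) = PadicInt.toZModPow k' z * lam a)
    (Ψ : galoisCohomology (S.T.ρ j) 1 →+ galoisCohomology ((S.T.ρ j).tateDual (p ^ k')) 1)
    (hΨ : ∀ (φ : contOneCocycles (S.T.ρ j).toTopRep) (ψ : contOneCocycles ((S.T.ρ j).tateDual (p ^ k')).toTopRep),
      (∀ g, ψ.1 g = ((S.D j).toTateDual lam hlam exp hexp).toContinuousLinearMap.toLinearMap.toAddMonoidHom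
        (φ.1 (S.cd.conj g))) → Ψ (oneCocycleClass _ φ) = oneCocycleClass _ ψ)
    (r : R) (c : galoisCohomology (S.T.ρ j) 1) :
    Ψ (scalarMapH1 (S.T.ρ j) (S.T.hlin j) r c) =
      ContinuousRep.cohomologyMap ((S.T.ρ j).tateDual (p ^ k')) ((S.T.ρ j).tateDual (p ^ k'))
        (pairingDualHom (p ^ k') ((tateDualEval K (N j) (p ^ k')).comp (DistribSMul.toAddMonoidHom (N j) r)))
        continuous_of_discreteTopology
        (pairingDualHom_smul (pairing_comp_smul (S.T.ρ j) (S.T.ρ j) (p ^ k') (DistribSMul.toAddMonoidHom (N j) r)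
          (fun g y => (S.T.hlin j g r y).symm))) 1 (Ψ c) :=
  conjTransfer_scalarMapH1 S.cd (S.T.ρ j) (S.T.hlin j) ((S.T.ρ j).tateDual (p ^ k')) _
    ((S.D j).toTateDual_semilinear lam hlam exp hexp) _ _ r
    (fun m => (S.D j).toTateDual_apply_eq_pairingDualHom lam hlam exp hexp (DistribSMul.toAddMonoidHom (N j) r)
      (fun s t => S.e_level_smul_comm j r s t) m) Ψ hΨ c

/-- **THE DUAL SLOT ON HOWARD'S `R`-MODULE `𝓗_j(n) = S.selmerModuleAt hy j n`** (LEAD g14's Q4 as worded, at every level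
`j`): for a `DVRSetting` with H.0–H.5 and `p ∤ #𝓞_K^×`, `p^{k'} ∈ 𝔪^{e_j}`, a bijective trivialisation `exp`, a Frobenius `λ` of
`R_j`, a family `inv` with local Tate duality, `n ⊆ 𝓛^{(j)}` and the transfer `Ψ` along `Θ_j`: an additive BIJECTION
`e : 𝓗_j(n) ≃ H¹_{𝓕(n)_j^*}(K, T^{(j)∨}(1))` with `↑(e c) = Ψ c` and **`↑(e (r • c)) = H¹(r^D) ↑(e c)`** for every `r ∈ R`
(`r^D` the transpose of `r•`, as in `TowerSelmerTransposeDualSelmerProofs`).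
[cite: Howard2004HeegnerKolyvagin, Prop. 1.4.1 and Thm. 1.4.2 proof (arXiv:1202.6340 p0008 L83–98, L120–124), §1.3 H.4/H.5] [cite: MilneADT2006, Ch. I Cor. 2.3] -/
theorem exists_addEquiv_selmerModuleAt_dualSelmerGroup [∀ k, Finite (N k)] (S : DVRSetting p K R N Rk Nbar Nq)
    (hy : S.SatisfiesH) (hu : ¬ p ∣ Nat.card (𝓞 K)ˣ) (j : ℕ) {k' : ℕ}
    (hk' : ((p : ℕ) : R) ^ k' ∈ IsLocalRing.maximalIdeal R ^ S.e j)
    (exp : ZMod (p ^ k') →+ MuCarrier K (p ^ k'))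
    (hexp : ∀ (g : absoluteGaloisGroup K) (x : ZMod (p ^ k')),
      exp (cyclotomicCharacterModPow K p k' g * x) = mu K (p ^ k') g (exp x))
    (hexpb : Bijective exp) (lam : Rk j →+ ZMod (p ^ k'))
    (hlam : ∀ (z : ℤ_[p]) (a : Rk j), lam (algebraMap ℤ_[p] (Rk j) z * a) = PadicInt.toZModPow k' z * lam a)
    (hfrob : Bijective ((AddMonoidHom.mul : Rk j →+ Rk j →+ Rk j).compr₂ lam))
    (inv : LocalInvariants K (p ^ k')) (hperf : inv.IsPerfect)
    {n : Finset (HeightOneSpectrum (𝓞 K))} (hn : ↑n ⊆ S.levelPrimes j)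
    (Ψ : galoisCohomology (S.T.ρ j) 1 →+ galoisCohomology ((S.T.ρ j).tateDual (p ^ k')) 1)
    (hΨ : ∀ (φ : contOneCocycles (S.T.ρ j).toTopRep) (ψ : contOneCocycles ((S.T.ρ j).tateDual (p ^ k')).toTopRep),
      (∀ g, ψ.1 g = ((S.D j).toTateDual lam hlam exp hexp).toContinuousLinearMap.toLinearMap.toAddMonoidHom
        (φ.1 (S.cd.conj g))) → Ψ (oneCocycleClass _ φ) = oneCocycleClass _ ψ) :
    ∃ e : ↥(S.selmerModuleAt hy j n) ≃+
        ↥(inv.dualSelmerStructure (S.T.ρ j) ((S.t j).atLevel S.jbar n).cond).selmerGroup,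
      (∀ c, ((e c : ↥(inv.dualSelmerStructure (S.T.ρ j) ((S.t j).atLevel S.jbar n).cond).selmerGroup) :
        galoisCohomology ((S.T.ρ j).tateDual (p ^ k')) 1) = Ψ c) ∧
      ∀ (r : R) (c : ↥(S.selmerModuleAt hy j n)),
        ((e (r • c) : ↥(inv.dualSelmerStructure (S.T.ρ j) ((S.t j).atLevel S.jbar n).cond).selmerGroup) :
          galoisCohomology ((S.T.ρ j).tateDual (p ^ k')) 1) =
        ContinuousRep.cohomologyMap ((S.T.ρ j).tateDual (p ^ k')) ((S.T.ρ j).tateDual (p ^ k'))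
          (pairingDualHom (p ^ k') ((tateDualEval K (N j) (p ^ k')).comp (DistribSMul.toAddMonoidHom (N j) r)))
          continuous_of_discreteTopology
          (pairingDualHom_smul (pairing_comp_smul (S.T.ρ j) (S.T.ρ j) (p ^ k') (DistribSMul.toAddMonoidHom (N j) r)
            (fun g y => (S.T.hlin j g r y).symm))) 1
          ((e c : ↥(inv.dualSelmerStructure (S.T.ρ j) ((S.t j).atLevel S.jbar n).cond).selmerGroup) :
            galoisCohomology ((S.T.ρ j).tateDual (p ^ k')) 1) := by
  obtain ⟨e₀, he₀⟩ := S.exists_addEquiv_selmerGroup_atLevel_dualSelmerGroup hy hu j hk' exp hexp hexpb lam hlam hfrob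
    inv hperf hn Ψ hΨ
  -- Howard's `R`-module `𝓗_j(n)` has the Selmer group of `𝓕(n)_j` as underlying subgroup (`mem_selmerModuleAt_iff`)
  let ι : ↥(S.selmerModuleAt hy j n) ≃+ ↥((S.t j).atLevel S.jbar n).cond.selmerGroup :=
    { toFun := fun c => ⟨c.1, c.2⟩
      invFun := fun c => ⟨c.1, c.2⟩
      left_inv := fun _ => rfl
      right_inv := fun _ => rfl
      map_add' := fun _ _ => rfl }
  have he : ∀ c : ↥(S.selmerModuleAt hy j n),
      (((ι.trans e₀) c : ↥(inv.dualSelmerStructure (S.T.ρ j) ((S.t j).atLevel S.jbar n).cond).selmerGroup) :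
        galoisCohomology ((S.T.ρ j).tateDual (p ^ k')) 1) = Ψ c := fun c => he₀ (ι c)
  refine ⟨ι.trans e₀, he, fun r c => ?_⟩
  rw [he, he]
  exact S.conjTransfer_scalarMapH1_level j exp hexp lam hlam Ψ hΨ r c

end DVRSetting

/-! ## §4 The residual twin -/

namespace DVRSetting

variable {p : ℕ} [Fact p.Prime] {K : Type} [Field K] [NumberField K]
  {R : Type} [CommRing R] [IsDomain R] [IsDiscreteValuationRing R] [Algebra ℤ_[p] R]
  {N : ℕ → Type} [∀ k, AddCommGroup (N k)] [∀ k, TopologicalSpace (N k)]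
  [∀ k, DiscreteTopology (N k)] [∀ k, Module R (N k)]
  {Rk : ℕ → Type} [∀ k, CommRing (Rk k)] [∀ k, IsLocalRing (Rk k)] [∀ k, TopologicalSpace (Rk k)]
  [∀ k, DiscreteTopology (Rk k)] [∀ k, Algebra ℤ_[p] (Rk k)] [∀ k, Algebra R (Rk k)]
  [∀ k, Module (Rk k) (N k)] [∀ k, IsScalarTower R (Rk k) (N k)]
  {Nbar : Type} [AddCommGroup Nbar] [TopologicalSpace Nbar] [DiscreteTopology Nbar]
  [∀ k, Module (Rk k) Nbar]
  {Nq : ℕ → Finset (HeightOneSpectrum (𝓞 K)) → Type} [∀ k n, AddCommGroup (Nq k n)]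
  [∀ k n, TopologicalSpace (Nq k n)] [∀ k n, DiscreteTopology (Nq k n)]
  [∀ k n, Module (Rk k) (Nq k n)] [∀ k n, Module R (Nq k n)]
  [∀ k n, IsScalarTower R (Rk k) (Nq k n)]

/-- **`Ψ̄ (H¹(r•) c) = H¹(r^D) (Ψ̄ c)` at the residual level** (`T̄`, scalars `r ∈ R_k`, any residual duality datum `D̄`, the
transfer `Ψ̄` along `Θ̄ = D̄.toTateDual λ exp`). [cite: Howard2004HeegnerKolyvagin, Prop. 1.4.1 and Thm. 1.4.2 proof (arXiv:1202.6340 p0008 L83–98, L120–124)] [cite: MilneADT2006, Ch. I §2] -/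
theorem conjTransfer_scalarMapH1_residual [Finite Nbar] (S : DVRSetting p K R N Rk Nbar Nq) (hy : S.SatisfiesH) (k : ℕ)
    {k' : ℕ} (exp : ZMod (p ^ k') →+ MuCarrier K (p ^ k'))
    (hexp : ∀ (g : absoluteGaloisGroup K) (x : ZMod (p ^ k')),
      exp (cyclotomicCharacterModPow K p k' g * x) = mu K (p ^ k') g (exp x))
    (Dbar : DualityDatum p S.cd S.ρbar (Rk k)) (lam : Rk k →+ ZMod (p ^ k'))
    (hlam : ∀ (z : ℤ_[p]) (a : Rk k), lam (algebraMap ℤ_[p] (Rk k) z * a) = PadicInt.toZModPow k' z * lam a)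
    (Ψ : galoisCohomology S.ρbar 1 →+ galoisCohomology (S.ρbar.tateDual (p ^ k')) 1)
    (hΨ : ∀ (φ : contOneCocycles S.ρbar.toTopRep) (ψ : contOneCocycles (S.ρbar.tateDual (p ^ k')).toTopRep),
      (∀ g, ψ.1 g = (Dbar.toTateDual lam hlam exp hexp).toContinuousLinearMap.toLinearMap.toAddMonoidHom
        (φ.1 (S.cd.conj g))) → Ψ (oneCocycleClass _ φ) = oneCocycleClass _ ψ)
    (r : Rk k) (c : galoisCohomology S.ρbar 1) :
    Ψ (scalarMapH1 S.ρbar (S.isScalarLinear_rhobar hy k) r c) =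
      ContinuousRep.cohomologyMap (S.ρbar.tateDual (p ^ k')) (S.ρbar.tateDual (p ^ k'))
        (pairingDualHom (p ^ k') ((tateDualEval K Nbar (p ^ k')).comp (DistribSMul.toAddMonoidHom Nbar r)))
        continuous_of_discreteTopology
        (pairingDualHom_smul (pairing_comp_smul S.ρbar S.ρbar (p ^ k') (DistribSMul.toAddMonoidHom Nbar r)
          (fun g y => (S.isScalarLinear_rhobar hy k g r y).symm))) 1 (Ψ c) :=
  Dbar.conjTransfer_scalarMapH1_toTateDual lam hlam exp hexp (S.isScalarLinear_rhobar hy k) r Ψ hΨ c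

end DVRSetting

/-! ## §5 The (ISO) letter in the binder shape of the class-level skew identity -/

namespace DVRSetting

variable {p : ℕ} [Fact p.Prime] {K : Type} [Field K] [NumberField K]
  {R : Type} [CommRing R] [IsDomain R] [IsDiscreteValuationRing R] [Algebra ℤ_[p] R]
  {N : ℕ → Type} [∀ k, AddCommGroup (N k)] [∀ k, TopologicalSpace (N k)]
  [∀ k, DiscreteTopology (N k)] [∀ k, Module R (N k)]
  {Rk : ℕ → Type} [∀ k, CommRing (Rk k)] [∀ k, IsLocalRing (Rk k)] [∀ k, TopologicalSpace (Rk k)]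
  [∀ k, DiscreteTopology (Rk k)] [∀ k, Algebra ℤ_[p] (Rk k)] [∀ k, Algebra R (Rk k)]
  [∀ k, Module (Rk k) (N k)] [∀ k, IsScalarTower R (Rk k) (N k)]
  {Nbar : Type} [AddCommGroup Nbar] [TopologicalSpace Nbar] [DiscreteTopology Nbar]
  [∀ k, Module (Rk k) Nbar]
  {Nq : ℕ → Finset (HeightOneSpectrum (𝓞 K)) → Type} [∀ k n, AddCommGroup (Nq k n)]
  [∀ k n, TopologicalSpace (Nq k n)] [∀ k n, DiscreteTopology (Nq k n)]
  [∀ k n, Module (Rk k) (Nq k n)] [∀ k n, Module R (Nq k n)]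
  [∀ k n, IsScalarTower R (Rk k) (Nq k n)]

/-- **(ISO) — `⟨ℓ, T^j_w ℓ′⟩_w = 0` for `ℓ ∈ 𝓕(n)_{j,w}`, `ℓ′ ∈ 𝓕(n)_{j,σw}`** at every level `j` of a `DVRSetting` with H.0–H.5
and `p ∤ #𝓞_K^×` (`n ⊆ 𝓛^{(j)}`, `p^{k′} ∈ 𝔪^{e_j}`, bijective `exp`, local Tate duality `IsPerfect` for `inv`, and ANY
`ℤ_p`-semilinear `λ : R_j → ℤ/p^{k′}`), where `T^j_w = H¹(Θ_j) ∘ transport_w` is written in the BRIDGE spelling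
`galoisCohomology.map (localMap Θ_j w) 1` of `ResidualLevelLocalPairingFlipProofs` / `TowerCasselsTatePairingSkewSumProofs`
(VERBATIM the binder `hISO` of `sum_defectPairing_add_sum_defectPairing_eq_zero` at `j = t+1`): H.4 for `𝓕(n)_j`
(`map_toTateDual_transportH1_atLevel_le_dualLocalCondition`), read through `mem_dualLocalCondition_iff` and the bridge
`map_localMap_toTateDual_eq_cohomologyMap`.
[cite: Howard2004HeegnerKolyvagin, §1.3 H.4 for `𝓕(n)` (arXiv:1202.6340 p. 7 L69–82) and Lemma 1.5.6 (p. 10 L86–88)] [cite: MilneADT2006, Ch. I Cor. 2.3] -/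
theorem localTatePairingZMod_map_transportH1_eq_zero_of_mem_atLevel [∀ k, Finite (N k)]
    (S : DVRSetting p K R N Rk Nbar Nq) (hy : S.SatisfiesH) (hu : ¬ p ∣ Nat.card (𝓞 K)ˣ) (j : ℕ) {k' : ℕ}
    (hk' : ((p : ℕ) : R) ^ k' ∈ IsLocalRing.maximalIdeal R ^ S.e j)
    (exp : ZMod (p ^ k') →+ MuCarrier K (p ^ k'))
    (hexp : ∀ (g : absoluteGaloisGroup K) (x : ZMod (p ^ k')),
      exp (cyclotomicCharacterModPow K p k' g * x) = mu K (p ^ k') g (exp x))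
    (hexpb : Bijective exp) (lam : Rk j →+ ZMod (p ^ k'))
    (hlam : ∀ (z : ℤ_[p]) (a : Rk j), lam (algebraMap ℤ_[p] (Rk j) z * a) = PadicInt.toZModPow k' z * lam a)
    (inv : LocalInvariants K (p ^ k')) (hperf : inv.IsPerfect)
    {n : Finset (HeightOneSpectrum (𝓞 K))} (hn : ↑n ⊆ S.levelPrimes j) (w : HeightOneSpectrum (𝓞 K))
    (ℓ : galoisCohomology ((S.T.ρ j).toLocal (Sum.inr w)) 1) (hℓ : ℓ ∈ ((S.t j).atLevel S.jbar n).cond (Sum.inr w))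
    (ℓ' : galoisCohomology ((S.T.ρ j).toLocal (Sum.inr (S.cd.σ • w))) 1)
    (hℓ' : ℓ' ∈ ((S.t j).atLevel S.jbar n).cond (Sum.inr (S.cd.σ • w))) :
    localTatePairingZMod (S.T.ρ j) (p ^ k') (Sum.inr w) (inv (Sum.inr w)) ℓ
      (galoisCohomology.map (Literature.NumberTheory.EllipticCurves.DiscreteGaloisModule.localMap
        ((S.D j).toTateDual lam hlam exp hexp) (Sum.inr w)) 1 (S.cd.transportH1 (S.T.ρ j) w ℓ')) = 0 := by
  have hmem := S.map_toTateDual_transportH1_atLevel_le_dualLocalCondition hy hu j hk' exp hexp hexpb lam hlam inv hperf hn w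
    (AddSubgroup.mem_map_of_mem _ hℓ')
  rw [(S.D j).map_localMap_toTateDual_eq_cohomologyMap lam hlam exp hexp (Sum.inr w)]
  exact (LocalInvariants.mem_dualLocalCondition_iff _ _ _ _ _).1 hmem ℓ hℓ

/-- **`Ψ_j` carries `H¹_{𝓕(n)_j}(K, T^{(j)})` into the dual Selmer group `H¹_{𝓕(n)_j^*}(K, T^{(j)∨}(1))`** — membership only, for
ANY `ℤ_p`-semilinear `λ_j` (no Frobenius property, no bijectivity of `Θ_j`: H.4 for `𝓕(n)_j` and the totality of the dual
structure at the complex place suffice; slice 2's `conjTransfer_mem_dualSelmerGroup`).  At `j = t+1` this is the input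
«`Ψ_{t+1} z ∈ Sel^*_{t+1}`» of the right-kernel inclusion.
[cite: Howard2004HeegnerKolyvagin, Thm. 1.4.2 proof (arXiv:1202.6340 p0008 L120–124) with §1.3 H.4] [cite: MilneADT2006, Ch. I Cor. 2.3] -/
theorem conjTransfer_mem_dualSelmerGroup_atLevel [∀ k, Finite (N k)]
    (S : DVRSetting p K R N Rk Nbar Nq) (hy : S.SatisfiesH) (hu : ¬ p ∣ Nat.card (𝓞 K)ˣ) (j : ℕ) {k' : ℕ}
    (hk' : ((p : ℕ) : R) ^ k' ∈ IsLocalRing.maximalIdeal R ^ S.e j)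
    (exp : ZMod (p ^ k') →+ MuCarrier K (p ^ k'))
    (hexp : ∀ (g : absoluteGaloisGroup K) (x : ZMod (p ^ k')),
      exp (cyclotomicCharacterModPow K p k' g * x) = mu K (p ^ k') g (exp x))
    (hexpb : Bijective exp) (lam : Rk j →+ ZMod (p ^ k'))
    (hlam : ∀ (z : ℤ_[p]) (a : Rk j), lam (algebraMap ℤ_[p] (Rk j) z * a) = PadicInt.toZModPow k' z * lam a)
    (inv : LocalInvariants K (p ^ k')) (hperf : inv.IsPerfect)
    {n : Finset (HeightOneSpectrum (𝓞 K))} (hn : ↑n ⊆ S.levelPrimes j)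
    (Ψ : galoisCohomology (S.T.ρ j) 1 →+ galoisCohomology ((S.T.ρ j).tateDual (p ^ k')) 1)
    (hΨ : ∀ (φ : contOneCocycles (S.T.ρ j).toTopRep) (ψ : contOneCocycles ((S.T.ρ j).tateDual (p ^ k')).toTopRep),
      (∀ g, ψ.1 g = ((S.D j).toTateDual lam hlam exp hexp).toContinuousLinearMap.toLinearMap.toAddMonoidHom
        (φ.1 (S.cd.conj g))) → Ψ (oneCocycleClass _ φ) = oneCocycleClass _ ψ)
    {z : galoisCohomology (S.T.ρ j) 1} (hz : z ∈ ((S.t j).atLevel S.jbar n).cond.selmerGroup) :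
    Ψ z ∈ (inv.dualSelmerStructure (S.T.ρ j) ((S.t j).atLevel S.jbar n).cond).selmerGroup :=
  (S.D j).conjTransfer_mem_dualSelmerGroup lam hlam exp hexp _
    (S.isSelfOrthogonal_atLevel hy hu j hk' exp hexp hexpb inv hperf hn) inv
    (fun w x => S.mem_dualSelmerStructure_inl hy j inv _ w x) Ψ hΨ hz

/-- **`loc_w (Ψ_j c) = T^j_w (loc_{σw} c)`** — the localisation of the slot at a finite place `w`, in the BRIDGE spelling
`T^j_w = galoisCohomology.map (localMap Θ_j w) 1 ∘ transport_w` of `TowerCasselsTatePairingSkewSumProofs` (the binders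
`hWa` / `hWb` / `hWb'` of `sum_defectPairing_add_sum_defectPairing_eq_zero`): slice 1's `conjTransfer_localization` read through
the bridge `map_localMap_toTateDual_eq_cohomologyMap`.
[cite: Howard2004HeegnerKolyvagin, Thm. 1.4.2 proof (arXiv:1202.6340 p0008 L120–124) and Def. 1.1.1 (`loc_v`)] [cite: SerreGaloisCohomology1997, Ch. I §2.4 (compatible pairs)] -/
theorem conjTransfer_localization_level [∀ k, Finite (N k)] (S : DVRSetting p K R N Rk Nbar Nq) (j : ℕ) {k' : ℕ}
    (exp : ZMod (p ^ k') →+ MuCarrier K (p ^ k'))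
    (hexp : ∀ (g : absoluteGaloisGroup K) (x : ZMod (p ^ k')),
      exp (cyclotomicCharacterModPow K p k' g * x) = mu K (p ^ k') g (exp x))
    (lam : Rk j →+ ZMod (p ^ k'))
    (hlam : ∀ (z : ℤ_[p]) (a : Rk j), lam (algebraMap ℤ_[p] (Rk j) z * a) = PadicInt.toZModPow k' z * lam a)
    (Ψ : galoisCohomology (S.T.ρ j) 1 →+ galoisCohomology ((S.T.ρ j).tateDual (p ^ k')) 1)
    (hΨ : ∀ (φ : contOneCocycles (S.T.ρ j).toTopRep) (ψ : contOneCocycles ((S.T.ρ j).tateDual (p ^ k')).toTopRep),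
      (∀ g, ψ.1 g = ((S.D j).toTateDual lam hlam exp hexp).toContinuousLinearMap.toLinearMap.toAddMonoidHom
        (φ.1 (S.cd.conj g))) → Ψ (oneCocycleClass _ φ) = oneCocycleClass _ ψ)
    (w : HeightOneSpectrum (𝓞 K)) (c : galoisCohomology (S.T.ρ j) 1) :
    galoisCohomology.localization ((S.T.ρ j).tateDual (p ^ k')) (Sum.inr w) 1 (Ψ c) =
      galoisCohomology.map (Literature.NumberTheory.EllipticCurves.DiscreteGaloisModule.localMap
        ((S.D j).toTateDual lam hlam exp hexp) (Sum.inr w)) 1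
        (S.cd.transportH1 (S.T.ρ j) w (galoisCohomology.localization (S.T.ρ j) (Sum.inr (S.cd.σ • w)) 1 c)) := by
  rw [(S.D j).map_localMap_toTateDual_eq_cohomologyMap lam hlam exp hexp (Sum.inr w)]
  exact conjTransfer_localization S.cd (S.T.ρ j) _ _ ((S.D j).toTateDual_semilinear lam hlam exp hexp) Ψ hΨ w c

end DVRSetting

end Literature.NumberTheory.GaloisCohomology.Howard2004

end
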